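import Summits.CriticalPhenomena.Ising3DConformalLimit.Theses.MonotoneRG
import Summits.CriticalPhenomena.Ising3DConformalLimit.Theorems.ExistsScaleCovariantLimit.Negative.TightnessUniqueness
import Summits.CriticalPhenomena.Ising3DConformalLimit.Theorems.HyperoctahedralRPExistsScaleCovariantLimitRegularityGivesPrecompact
import Summits.CriticalPhenomena.Ising3DConformalLimit.Theorems.HyperoctahedralRPExistsScaleCovariantLimitDyadicLimitContinuous
import HarnessLib

/-!
# `OrbitPrecompact` (item stmt-CriticalPhenomena-5955) gives `UniformRegularity`
(item stmt-CriticalPhenomena-4658) — registered stub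
`stub_uniformRegularity_of_orbitPrecompact` (glue "UR′") of line `Sketch` of the crux
`ExistsScaleCovariantLimit` (item stmt-CriticalPhenomena-1981)

The Arzelà–Ascoli CONVERSE of the landed `stub_regularityGivesPrecompact` (4658 ⟹ 5955), making the
two compactness items EQUIVALENT. Everything is by contradiction along mesh sequences
`δ_k ∈ (0, 1/(k+1))`:

* `tight_nondeg_of_orbitPrecompact`: `OrbitPrecompact` (precompactness of the `ρ`-zoom for SOME
  `ρ > 0`, with non-degenerate cluster points) gives, as in `tight_of_orbitPrecompact`, that every
  mesh sequence in `(0,1]` tending to `0⁺` has a subsequence along which the PINNED zoom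
  (`ρ_pin(δ) = ⟨σ₀σ_{⌊1/δ⌋e₀}⟩^{-1/2}`) converges for all `n` locally uniformly off the diagonals —
  the pinned cluster point being the positive multiple `(S₂(0,e₀))^{-n/2} · S n` of the `ρ`-cluster
  point `S`, it is again NON-DEGENERATE; and it is continuous off the diagonals
  (`continuousOn_seqLimit`).
* three abstract lemmas on a compact `K` of a pseudo-metric space, under the sequential hypothesis
  "every `δ_k ∈ (0, 1/(k+1))` has a subsequence along which `F δ_{φ k} → f` uniformly on `K`, `f`
  continuous on `K`": (a) `exists_bound_Ioo_of_seqCompact` — an unbounded sequence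
  `|F δ_k x_k| > k` contradicts uniform convergence to a bounded limit; (b)
  `equicontinuous_Ioo_of_seqCompact` — `dist x_k y_k → 0` with `|F δ_k x_k − F δ_k y_k| ≥ ε`
  contradicts uniform convergence plus Heine–Cantor for `f` on `K`; (c)
  `exists_pos_lower_Ioo_of_seqCompact` — `F δ_k x_k < 1/(k+1)` contradicts uniform convergence to a
  limit with positive minimum on `K` (when `f > 0` on `K`).
* `stub_uniformRegularity_of_orbitPrecompact`: the renormalisation written inline in
  `UniformRegularity` is `rhoPin` (`rhoStar_eq_rhoPin`); clauses (a), (b), (c) are the three lemmas.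

References: folklore (uniform convergence on compacts, Heine–Cantor, extreme value theorem);
tree facts `rescaled_pin_eq`, `seqLimit_isBoundedUnder`, `cfg01_mem`, `continuousOn_seqLimit`,
`rhoStar_eq_rhoPin`. No definitions are introduced; no unproved fact is used.
-/

noncomputable section

open Literature.Probability.LatticeModels Filter Set
open scoped Topology
open Summit.CriticalPhenomena.Ising3DConformalLimit.MoebiusLimitExistsOnlyInteraction (rhoPin)

namespace Summit.CriticalPhenomena.Ising3DConformalLimit.Cruxes.ExistsScaleCovariantLimit.TwoHierarchies

open Summit.CriticalPhenomena.Ising3DConformalLimit.PinnedClusterPoints (cfg01_mem rescaled_pin_eq)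
open Summit.CriticalPhenomena.Ising3DConformalLimit.ExistsScaleCovariantLimitNegative
  (seqLimit_isBoundedUnder)

/-! ### Pinned tightness with non-degenerate cluster points -/

/-- **`OrbitPrecompact` ⟹ tightness of the PINNED zoom with NON-DEGENERATE, locally uniform
cluster points.** As in `ExistsScaleCovariantLimitNegative.tight_of_orbitPrecompact`: along the
subsequence given by `OrbitPrecompact` for the `ρ`-zoom (limit `S`, `S₂ > 0` off the diagonal), the
pinned zoom is `r_k^n · (ρ-zoom)` with `r_k → (S₂(0,e₀))^{-1/2} > 0` (`rescaled_pin_eq`), so it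
converges locally uniformly to `((S₂(0,e₀))^{-1/2})^n · S n`, whose two-point function is again
positive off the diagonal. [folklore] -/
theorem tight_nondeg_of_orbitPrecompact
    (h : Summit.CriticalPhenomena.Ising3DConformalLimit.Theses.MonotoneRG.OrbitPrecompact) :
    ∀ u : ℕ → ℝ, (∀ k, u k ∈ Set.Ioc (0:ℝ) 1) → Tendsto u atTop (𝓝[>] (0:ℝ)) →
      ∃ φ : ℕ → ℕ, StrictMono φ ∧ ∃ S : CorrFamily 3, IsNondegenerateTwoPoint S ∧ ∀ n,
        TendstoLocallyUniformlyOn (fun k => rescaledCorrelator (criticalCorr 3) rhoPin n (u (φ k)))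
          (S n) atTop (NonCoincident 3 n) := by
  -- adapted from `ExistsScaleCovariantLimitNegative.tight_of_orbitPrecompact` (non-degeneracy kept)
  obtain ⟨ρ, hρ, h⟩ := h
  intro u hu1 hu
  have hu0 : Tendsto u atTop (𝓝 0) := (tendsto_nhdsWithin_iff.1 hu).1
  obtain ⟨φ, S, hφ, hnd, hconv⟩ := h u hu1 hu0
  set cfg : Fin 2 → EuclideanSpace ℝ (Fin 3) := ![0, EuclideanSpace.single 0 1] with hcfg
  have hA : 0 < S 2 cfg := hnd _ cfg01_mem
  refine ⟨φ, hφ, fun n x => ((S 2 cfg) ^ (-(1 / 2 : ℝ))) ^ n * S n x, ?_, fun n => ?_⟩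
  · -- non-degeneracy: a positive multiple of a positive two-point function
    intro x hx
    exact mul_pos (pow_pos (Real.rpow_pos_of_pos hA _) 2) (hnd x hx)
  set r : ℕ → ℝ := fun k => (rescaledCorrelator (criticalCorr 3) ρ 2 (u (φ k)) cfg) ^ (-(1 / 2 : ℝ))
    with hr
  have hr_t : Tendsto (fun k => r k ^ n) atTop (𝓝 (((S 2 cfg) ^ (-(1 / 2 : ℝ))) ^ n)) :=
    ((((hconv 2).tendsto_at cfg01_mem).rpow_const (p := -(1 / 2 : ℝ)) (Or.inl hA.ne')).pow n)
  have hF1 : TendstoLocallyUniformlyOn (fun k (_ : Fin n → EuclideanSpace ℝ (Fin 3)) => r k ^ n)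
      (fun _ => ((S 2 cfg) ^ (-(1 / 2 : ℝ))) ^ n) atTop (NonCoincident 3 n) :=
    (hr_t.tendstoUniformlyOn_const (NonCoincident 3 n)).tendstoLocallyUniformlyOn
  have hprod := hF1.mul₀_of_isBoundedUnder (hconv n)
    (fun x _ => isBoundedUnder_of ⟨dist (((S 2 cfg) ^ (-(1 / 2 : ℝ))) ^ n) 0, fun _ => le_rfl⟩)
    (fun x hx => seqLimit_isBoundedUnder n (hconv n) hx)
  refine hprod.congr fun k y _ => ?_
  exact (rescaled_pin_eq (hρ _ (hu1 (φ k))) n y).symm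

/-! ### Mesh sequences `δ_k ∈ (0, 1/(k+1))` -/

/-- A mesh sequence with `δ_k ∈ (0, 1/(k+1))` lies in `(0,1]`. [folklore] -/
theorem seqMesh_mem_Ioc {u : ℕ → ℝ} (hu : ∀ k : ℕ, u k ∈ Set.Ioo (0:ℝ) (1 / ((k:ℝ) + 1))) (k : ℕ) :
    u k ∈ Set.Ioc (0:ℝ) 1 := by
  refine ⟨(hu k).1, ((hu k).2.le).trans ?_⟩
  rw [div_le_one (by positivity)]
  linarith [(Nat.cast_nonneg k : (0:ℝ) ≤ k)]

/-- A mesh sequence with `δ_k ∈ (0, 1/(k+1))` tends to `0⁺`. [folklore] -/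
theorem seqMesh_tendsto_nhdsGT {u : ℕ → ℝ} (hu : ∀ k : ℕ, u k ∈ Set.Ioo (0:ℝ) (1 / ((k:ℝ) + 1))) :
    Tendsto u atTop (𝓝[>] (0:ℝ)) := by
  rw [tendsto_nhdsWithin_iff]
  refine ⟨?_, Filter.Eventually.of_forall fun k => (hu k).1⟩
  exact squeeze_zero (fun k => (hu k).1.le) (fun k => (hu k).2.le)
    tendsto_one_div_add_atTop_nhds_zero_nat

/-! ### Three abstract lemmas: sequential compactness on a compact set, by contradiction -/

/-- **(a) abstract.** If every mesh sequence `δ_k ∈ (0, 1/(k+1))` has a subsequence along which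
`F δ_{φ k} → f` uniformly on the compact `K` with `f` continuous on `K`, then `|F δ x| ≤ M` on `K`
for all `δ ∈ (0, δ₀)`: otherwise pick `δ_k ∈ (0, 1/(k+1))`, `x_k ∈ K` with `|F δ_k x_k| > k`; along
the subsequence, uniform convergence within `1` to `f`, bounded by `C` on `K`, gives
`φ k < |F δ_{φ k} x_{φ k}| ≤ C + 1` for all large `k`, absurd. [folklore] -/
theorem exists_bound_Ioo_of_seqCompact {X : Type*} [PseudoMetricSpace X]
    {F : ℝ → X → ℝ} {K : Set X} (hK : IsCompact K)
    (H : ∀ u : ℕ → ℝ, (∀ k : ℕ, u k ∈ Set.Ioo (0:ℝ) (1 / ((k:ℝ) + 1))) →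
      ∃ φ : ℕ → ℕ, StrictMono φ ∧ ∃ f : X → ℝ, ContinuousOn f K ∧
        TendstoUniformlyOn (fun k => F (u (φ k))) f atTop K) :
    ∃ M δ₀ : ℝ, 0 < δ₀ ∧ ∀ δ ∈ Set.Ioo 0 δ₀, ∀ x ∈ K, |F δ x| ≤ M := by
  by_contra hnot
  push Not at hnot
  have hseq : ∀ k : ℕ, ∃ δ ∈ Set.Ioo (0:ℝ) (1 / ((k:ℝ) + 1)), ∃ x ∈ K, (k:ℝ) < |F δ x| :=
    fun k => hnot (k:ℝ) _ Nat.one_div_pos_of_nat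
  choose u hu x hx hgt using hseq
  obtain ⟨φ, hφ, f, hf, hU⟩ := H u hu
  obtain ⟨C, hC⟩ := hK.exists_bound_of_continuousOn hf
  have hev : ∀ᶠ k in atTop, ∀ y ∈ K, dist (f y) (F (u (φ k)) y) < 1 :=
    Metric.tendstoUniformlyOn_iff.1 hU 1 one_pos
  obtain ⟨N, hN⟩ := exists_nat_gt (C + 1)
  obtain ⟨k, hk1, hk2⟩ := (hev.and (eventually_ge_atTop N)).exists
  have h1 : dist (f (x (φ k))) (F (u (φ k)) (x (φ k))) < 1 := hk1 _ (hx (φ k))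
  have h2 : ‖f (x (φ k))‖ ≤ C := hC _ (hx (φ k))
  have h3 : ((φ k : ℕ) : ℝ) < |F (u (φ k)) (x (φ k))| := hgt (φ k)
  have hφk : (k:ℝ) ≤ (φ k : ℝ) := by exact_mod_cast hφ.id_le k
  have hNk : (N:ℝ) ≤ (k:ℝ) := by exact_mod_cast hk2
  rw [Real.dist_eq] at h1
  rw [Real.norm_eq_abs] at h2
  have h4 := abs_sub_abs_le_abs_sub (F (u (φ k)) (x (φ k))) (f (x (φ k)))
  rw [abs_sub_comm] at h4
  linarith

/-- **(b) abstract.** Under the same sequential hypothesis, the `F δ`, `δ ∈ (0, δ₀)`, are uniformly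
equicontinuous on `K`: otherwise, for some `ε > 0`, pick `δ_k ∈ (0, 1/(k+1))` and `x_k, y_k ∈ K`
with `dist x_k y_k < 1/(k+1)` and `ε ≤ |F δ_k x_k − F δ_k y_k|`; along the subsequence, uniform
convergence within `ε/3` and uniform continuity of `f` on `K` (Heine–Cantor, modulus `η` for `ε/3`)
give `|F δ_{φ k} x_{φ k} − F δ_{φ k} y_{φ k}| < ε` once `1/(k+1) < η`, absurd. [folklore] -/
theorem equicontinuous_Ioo_of_seqCompact {X : Type*} [PseudoMetricSpace X]
    {F : ℝ → X → ℝ} {K : Set X} (hK : IsCompact K)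
    (H : ∀ u : ℕ → ℝ, (∀ k : ℕ, u k ∈ Set.Ioo (0:ℝ) (1 / ((k:ℝ) + 1))) →
      ∃ φ : ℕ → ℕ, StrictMono φ ∧ ∃ f : X → ℝ, ContinuousOn f K ∧
        TendstoUniformlyOn (fun k => F (u (φ k))) f atTop K) :
    ∀ ε : ℝ, 0 < ε → ∃ r δ₀ : ℝ, 0 < r ∧ 0 < δ₀ ∧ ∀ δ ∈ Set.Ioo 0 δ₀, ∀ x ∈ K, ∀ y ∈ K,
      dist x y < r → |F δ x - F δ y| < ε := by
  intro ε hε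
  by_contra hnot
  push Not at hnot
  have hseq : ∀ k : ℕ, ∃ δ ∈ Set.Ioo (0:ℝ) (1 / ((k:ℝ) + 1)), ∃ x ∈ K, ∃ y ∈ K,
      dist x y < 1 / ((k:ℝ) + 1) ∧ ε ≤ |F δ x - F δ y| :=
    fun k => hnot _ _ Nat.one_div_pos_of_nat Nat.one_div_pos_of_nat
  choose u hu x hx y hy hd hge using hseq
  obtain ⟨φ, hφ, f, hf, hU⟩ := H u hu
  have hε3 : 0 < ε / 3 := by positivity
  have hUC : UniformContinuousOn f K := hK.uniformContinuousOn_of_continuous hf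
  obtain ⟨η, hη, hηf⟩ := Metric.uniformContinuousOn_iff.1 hUC (ε / 3) hε3
  have hev : ∀ᶠ k in atTop, ∀ z ∈ K, dist (f z) (F (u (φ k)) z) < ε / 3 :=
    Metric.tendstoUniformlyOn_iff.1 hU (ε / 3) hε3
  have hevη : ∀ᶠ k : ℕ in atTop, 1 / ((k:ℝ) + 1) < η :=
    (tendsto_order.1 tendsto_one_div_add_atTop_nhds_zero_nat).2 η hη
  obtain ⟨k, hk1, hk2⟩ := (hev.and hevη).exists
  have hdk : dist (x (φ k)) (y (φ k)) < η :=
    lt_of_lt_of_le (hd (φ k)) ((Nat.one_div_le_one_div (hφ.id_le k)).trans hk2.le)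
  have h1 : dist (F (u (φ k)) (x (φ k))) (f (x (φ k))) < ε / 3 := by
    rw [dist_comm]; exact hk1 _ (hx (φ k))
  have h2 : dist (f (x (φ k))) (f (y (φ k))) < ε / 3 := hηf _ (hx (φ k)) _ (hy (φ k)) hdk
  have h3 : dist (f (y (φ k))) (F (u (φ k)) (y (φ k))) < ε / 3 := hk1 _ (hy (φ k))
  have hlt : |F (u (φ k)) (x (φ k)) - F (u (φ k)) (y (φ k))| < ε := by
    rw [← Real.dist_eq]
    calc dist (F (u (φ k)) (x (φ k))) (F (u (φ k)) (y (φ k)))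
        ≤ dist (F (u (φ k)) (x (φ k))) (f (x (φ k))) + dist (f (x (φ k))) (f (y (φ k))) +
            dist (f (y (φ k))) (F (u (φ k)) (y (φ k))) := dist_triangle4 _ _ _ _
      _ < ε / 3 + ε / 3 + ε / 3 := add_lt_add (add_lt_add h1 h2) h3
      _ = ε := by ring
  exact (not_le.2 hlt) (hge (φ k))

/-- **(c) abstract.** Under the same sequential hypothesis with, moreover, `f > 0` on `K`, there is
`m > 0` with `m ≤ F δ x` on `K` for all `δ ∈ (0, δ₀)`: otherwise pick `δ_k ∈ (0, 1/(k+1))`,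
`x_k ∈ K` with `F δ_k x_k < 1/(k+1)`; `K` is then nonempty, `f ≥ m₀ > 0` on `K` (extreme value
theorem), and along the subsequence uniform convergence within `m₀/2` gives
`m₀/2 < F δ_{φ k} x_{φ k} < 1/(k+1)` for all large `k`, absurd. [folklore] -/
theorem exists_pos_lower_Ioo_of_seqCompact {X : Type*} [PseudoMetricSpace X]
    {F : ℝ → X → ℝ} {K : Set X} (hK : IsCompact K)
    (H : ∀ u : ℕ → ℝ, (∀ k : ℕ, u k ∈ Set.Ioo (0:ℝ) (1 / ((k:ℝ) + 1))) →
      ∃ φ : ℕ → ℕ, StrictMono φ ∧ ∃ f : X → ℝ, ContinuousOn f K ∧ (∀ x ∈ K, 0 < f x) ∧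
        TendstoUniformlyOn (fun k => F (u (φ k))) f atTop K) :
    ∃ m δ₀ : ℝ, 0 < m ∧ 0 < δ₀ ∧ ∀ δ ∈ Set.Ioo 0 δ₀, ∀ x ∈ K, m ≤ F δ x := by
  by_contra hnot
  push Not at hnot
  have hseq : ∀ k : ℕ, ∃ δ ∈ Set.Ioo (0:ℝ) (1 / ((k:ℝ) + 1)), ∃ x ∈ K,
      F δ x < 1 / ((k:ℝ) + 1) :=
    fun k => hnot _ _ Nat.one_div_pos_of_nat Nat.one_div_pos_of_nat
  choose u hu x hx hlt using hseq
  obtain ⟨φ, hφ, f, hf, hpos, hU⟩ := H u hu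
  obtain ⟨m₀, hm₀, hlow⟩ := hK.exists_forall_le' hf hpos
  have hm2 : 0 < m₀ / 2 := by positivity
  have hev : ∀ᶠ k in atTop, ∀ z ∈ K, dist (f z) (F (u (φ k)) z) < m₀ / 2 :=
    Metric.tendstoUniformlyOn_iff.1 hU (m₀ / 2) hm2
  have hevm : ∀ᶠ k : ℕ in atTop, 1 / ((k:ℝ) + 1) < m₀ / 2 :=
    (tendsto_order.1 tendsto_one_div_add_atTop_nhds_zero_nat).2 _ hm2
  obtain ⟨k, hk1, hk2⟩ := (hev.and hevm).exists
  have h1 : dist (f (x (φ k))) (F (u (φ k)) (x (φ k))) < m₀ / 2 := hk1 _ (hx (φ k))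
  have h2 : m₀ ≤ f (x (φ k)) := hlow _ (hx (φ k))
  have h3 : F (u (φ k)) (x (φ k)) < 1 / ((k:ℝ) + 1) :=
    lt_of_lt_of_le (hlt (φ k)) (Nat.one_div_le_one_div (hφ.id_le k))
  rw [Real.dist_eq] at h1
  have h4 := (abs_lt.1 h1).2
  linarith

/-! ### The stub -/

/-- **UR′ — item stmt-CriticalPhenomena-5955 `OrbitPrecompact` gives item
stmt-CriticalPhenomena-4658 `UniformRegularity`** (the Arzelà–Ascoli converse of
`stub_regularityGivesPrecompact`, so the two compactness items are EQUIVALENT). The renormalisation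
written inline in `UniformRegularity` is `rhoPin` (`rhoStar_eq_rhoPin`). By
`tight_nondeg_of_orbitPrecompact`, every mesh sequence `δ_k ∈ (0, 1/(k+1))` has a subsequence along
which the pinned zoom converges, for all `n`, locally uniformly on `NonCoincident 3 n` — hence
uniformly on each compact `K ⊆ NonCoincident 3 n` — to a family `S` that is continuous there
(`continuousOn_seqLimit`) and has `S₂ > 0` off the diagonal; clauses (a), (b), (c) are then
`exists_bound_Ioo_of_seqCompact`, `equicontinuous_Ioo_of_seqCompact`,
`exists_pos_lower_Ioo_of_seqCompact`. [folklore] -/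
theorem stub_uniformRegularity_of_orbitPrecompact :
    Summit.CriticalPhenomena.Ising3DConformalLimit.Theses.MonotoneRG.OrbitPrecompact →
    Summit.CriticalPhenomena.Ising3DConformalLimit.Theses.MonotoneRG.UniformRegularity := by
  intro hpc
  unfold Summit.CriticalPhenomena.Ising3DConformalLimit.Theses.MonotoneRG.UniformRegularity
  rw [rhoStar_eq_rhoPin]
  have htight := tight_nondeg_of_orbitPrecompact hpc
  -- the sequential hypothesis: along `δ_k ∈ (0, 1/(k+1))`, a subsequence with a non-degenerate,
  -- continuous limit family, the convergence being uniform on compacts off the diagonals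
  have H : ∀ u : ℕ → ℝ, (∀ k : ℕ, u k ∈ Set.Ioo (0:ℝ) (1 / ((k:ℝ) + 1))) →
      ∃ φ : ℕ → ℕ, StrictMono φ ∧ ∃ S : CorrFamily 3, IsNondegenerateTwoPoint S ∧ ∀ n,
        ContinuousOn (S n) (NonCoincident 3 n) ∧
        ∀ K : Set (Fin n → EuclideanSpace ℝ (Fin 3)), IsCompact K → K ⊆ NonCoincident 3 n →
          TendstoUniformlyOn (fun k => rescaledCorrelator (criticalCorr 3) rhoPin n (u (φ k))) (S n)
            atTop K := by
    intro u hu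
    have hu0 : Tendsto u atTop (𝓝[>] (0:ℝ)) := seqMesh_tendsto_nhdsGT hu
    obtain ⟨φ, hφ, S, hnd, hS⟩ := htight u (seqMesh_mem_Ioc hu) hu0
    refine ⟨φ, hφ, S, hnd, fun n => ⟨?_, fun K hK hKs => ?_⟩⟩
    · exact continuousOn_seqLimit (u := u ∘ φ) (hu0.comp hφ.tendsto_atTop) (hS n)
    · exact (tendstoLocallyUniformlyOn_iff_tendstoUniformlyOn_of_compact hK).1 ((hS n).mono hKs)
  refine ⟨fun n K hKs hK => ⟨?_, ?_⟩, fun K hKs hK => ?_⟩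
  · -- (a) uniform bound on `K`
    refine exists_bound_Ioo_of_seqCompact hK fun u hu => ?_
    obtain ⟨φ, hφ, S, -, hS⟩ := H u hu
    exact ⟨φ, hφ, S n, (hS n).1.mono hKs, (hS n).2 K hK hKs⟩
  · -- (b) uniform equicontinuity on `K`
    refine equicontinuous_Ioo_of_seqCompact hK fun u hu => ?_
    obtain ⟨φ, hφ, S, -, hS⟩ := H u hu
    exact ⟨φ, hφ, S n, (hS n).1.mono hKs, (hS n).2 K hK hKs⟩
  · -- (c) positive lower bound of the pair zoom on `K`
    refine exists_pos_lower_Ioo_of_seqCompact hK fun u hu => ?_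
    obtain ⟨φ, hφ, S, hnd, hS⟩ := H u hu
    exact ⟨φ, hφ, S 2, (hS 2).1.mono hKs, fun x hx => hnd x (hKs hx), (hS 2).2 K hK hKs⟩

end Summit.CriticalPhenomena.Ising3DConformalLimit.Cruxes.ExistsScaleCovariantLimit.TwoHierarchies

end
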